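/-
Copyright: cell `langlands-arthur-audit` (papers/Langlands/langlands-arthur-audit), unit `pub-arthur-typer-g3`
(planner-pub-arthur-typer-g3-0, 2026-08-18).  Staged for the tree under `Literature/NumberTheory/Automorphic/KMSW2014/`
(LEAN-IN-TREE rule 2026-08-18).  File AFTER `KMSW2014/DependencyDag.lean` and `Arthur2013/Leaves/Register.lean`
(both landed); module map M15.
-/
import Literature.NumberTheory.Automorphic.KMSW2014.DependencyDag
import Literature.NumberTheory.Automorphic.Arthur2013.Leaves.Register
import HarnessLib

/-!
# KMSW (2014) audit — the symbolic DAG reads the typed leaves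

`KMSW2014/DependencyDag.lean` has one opaque `Prop` per node of arXiv:1409.3731v3 [KMSW] (inner forms of
unitary groups), with the PROVED scope (`T161g`, `LIRg`, `T171p`: generic parameters, pure inner twists) kept
apart from the starred statements AS STATED (`T161`, `LIR`, `T171`: deferred to the unwritten sequels [KMS_A],
[KMS_B]).  `Arthur2013/Leaves/*` types (i) the weighted-fundamental-lemma leaves with their STATED-versus-
CONSUMED regions and (ii) the LOCAL CLASSIFICATION STATEMENT `LocalClassification Ω D R` on a region `R` of
`LocalClassicalScope` (group type, inner-form class `form`, parameter kind), with [KMSW]'s regions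
`KMSW.localProved` (generic `ψ`) and `KMSW.localStated` (all `ψ`) and the separation
`LocalClassification.generic_separates`.  This module is the KMSW copy of `Arthur2013/Leaves/Bridge.lean`: a
`ReadsLeaves κ Ω D` structure under which (a) the paper's edge `E_StabOrdI` (untwisted stabilisation for inner twists,
"we need it [the general weighted FL]", main.tex l.69) is discharged from the typed leaves GIVEN the untwisted
case of [W4] (`ReadsLeaves.edge_StabOrdI_of_untwistedW4`); (b) the residue "printed split weighted FL ⊉ consumed
general weighted FL" is transported to KMSW's node level (`unwritten_general_not_implied`); (c) the hypothesis
mismatch "proved for generic parameters of (inner forms of) unitary groups over `p`-adic fields" versus "stated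
for all parameters" is transported to the node level: a reading with `T161g N` for every `N` and not `T161 N`
for every `N` (`generic_scope_not_full`).  Nothing is asserted; no `axiom`, no `sorry`.
-/

set_option autoImplicit false

namespace Literature.NumberTheory.Automorphic.KMSW2014

open Literature.NumberTheory.Automorphic.Arthur2013.Leaves

/-- `κ` READS `(Ω, D)`: the fundamental-lemma and STF nodes of the KMSW DAG are the typed leaves of
`Arthur2013/Leaves` on their consumed regions; the untwisted stabilisation node for inner twists is only
required to follow from the typed all-`G` untwisted identity; the local classification nodes, aggregated over
the rank, are the typed local classification statement on [KMSW]'s PROVED region (Theorem* 1.6.1 for generic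
`ψ`, `chap1mainthms.tex:L86`) resp. on its STATED region (all `ψ`).
[folklore] (the audit's own dictionary between its two layers, KMSW copy of `Arthur2013.Leaves.Reads`) -/
structure ReadsLeaves (κ : Nodes) (Ω : World) (D : ShapeData Ω) : Prop where
  /-- KL04 = L04 -/
  fl : κ.FL ↔ L04 Ω
  /-- KL05 = L05 -/
  wfl_split : κ.WFL_split ↔ L05 Ω
  /-- KL06 = L06 -/
  wfl_general : κ.WFL_general ↔ L06 Ω
  /-- KL07 = L10 -/
  stf : κ.STF_Arthur ↔ L10 Ω
  /-- KN-STABORD (the inner-twist unitary instances follow from the untwisted all-`G` statement, whose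
  `GlobalScope` carries every `form`) -/
  stabOrdI : StabTF Ω (fun s => StabTF.needed s ∧ s.twisted = false) → κ.StabOrdI
  /-- Theorem* 1.6.1 in the PROVED scope, all ranks = the typed statement on `KMSW.localProved` -/
  t161g : (∀ N, κ.T161g N) ↔ LocalClassification Ω D KMSW.localProved
  /-- Theorem* 1.6.1 AS STATED, all ranks = the typed statement on `KMSW.localStated` -/
  t161 : (∀ N, κ.T161 N) ↔ LocalClassification Ω D KMSW.localStated

variable {κ : Nodes} {Ω : World} {D : ShapeData Ω}

/-- Under a reading, the paper's edge E-STABORD — `chap3.tex:L33`, VERBATIM: "established by Arthur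
(\cite{ArtSTF1}, \cite{ArtSTF2}, \cite{ArtSTF3}). At the time Arthur's result had relied on the validity of the
ordinary and weighted fundamental lemmas, which were verified recently by Ng\^o, Waldspurger and Chaudouard-Laumon
(\cite{Ngo10}, \cite{Wal06}, \cite{Wal09}, \cite{CLWFL1}, \cite{CLWFL2})" and `main.tex:L69` "we need it for the
stabilization of the untwisted trace formula for inner forms of unitary groups" — is discharged from the typed
leaves GIVEN the untwisted case of [W4] (Introduction p.105, `θ = 1`: the weighted FL for groups from the
Lie-algebra lemma L06; `W4.IntroUntwisted` of `Arthur2013/Leaves/W4.lean`); the premises `WFL_split` and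
`Transfer` of the DAG edge are not what the typed edge consumes.
[cite: KalethaEtAl2014, §3.1 (arXiv:1409.3731v3 chap3.tex l.33) with main.tex l.69 (edge discharged here under the stated hypothesis)] -/
theorem ReadsLeaves.edge_StabOrdI_of_untwistedW4 (h : ReadsLeaves κ Ω D)
    (hW : L06 Ω → WFLGroup Ω WFLGroup.neededArthurSTF) : κ.E_StabOrdI :=
  fun fl _ g stf _ => h.stabOrdI ((h.stf.mp stf) (hW (h.wfl_general.mp g)) (h.fl.mp fl))

/-- Under a reading, the full local statement at every rank gives the proved scope at every rank (region
monotonicity `KMSW.localProved ⊆ KMSW.localStated`). [folklore] (bookkeeping) -/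
theorem ReadsLeaves.t161g_of_t161 (h : ReadsLeaves κ Ω D) : (∀ N, κ.T161 N) → ∀ N, κ.T161g N :=
  fun H => h.t161g.mpr (LocalClassification.mono Ω D (fun _ ⟨hU, hF, _⟩ => ⟨hU, hF⟩) (h.t161.mp H))

/-- The node assignment that reads `(Ω, D)` on the leaves of `ReadsLeaves` and agrees with `rest` elsewhere (the two
local classification nodes are read rank-free). [folklore] (construction) -/
def leafNodes (Ω : World) (D : ShapeData Ω) (rest : Nodes) : Nodes :=
  { rest with
    FL := L04 Ω, WFL_split := L05 Ω, WFL_general := L06 Ω, STF_Arthur := L10 Ω,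
    StabOrdI := StabTF Ω (fun s => StabTF.needed s ∧ s.twisted = false),
    T161g := fun _ => LocalClassification Ω D KMSW.localProved,
    T161 := fun _ => LocalClassification Ω D KMSW.localStated }

/-- `leafNodes Ω D rest` reads `(Ω, D)`. [folklore] (by construction) -/
theorem leafNodes_reads (Ω : World) (D : ShapeData Ω) (rest : Nodes) : ReadsLeaves (leafNodes Ω D rest) Ω D where
  fl := Iff.rfl
  wfl_split := Iff.rfl
  wfl_general := Iff.rfl
  stf := Iff.rfl
  stabOrdI := id
  t161g := ⟨fun H => H 0, fun H _ => H⟩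
  t161 := ⟨fun H => H 0, fun H _ => H⟩

/-- Shape data available in EVERY world: all parameters get the empty shape, index `1` (used only to transport
the weighted-FL separation, which does not read packets). [folklore] (explicit structure) -/
def emptyShape (Ω : World) : ShapeData Ω where
  shape _ _ := { k := 0, lbl := fun i => i.elim0, dimφ := fun i => i.elim0, d := fun i => i.elim0,
                 d_pos := fun i => i.elim0, dimBad := 0 }
  indexGG0 _ := 1

/-- **Node-level residue under [KMSW], kernel-checked (KL06).**  For any values of the other nodes there is a
reading in which the printed leaf `WFL_split` (KL05, `chap3.tex:L33` with its footnote "At the time of writing,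
Chaudouard and Laumon have not completed their series of papers") holds and the leaf `WFL_general` that the
PROVED scope consumes (KL06, `main.tex:L69`; hypothesis `UnwrittenLeaves` of `KMSW2014.Nodes.scope_of_leaves`)
fails.  Transported from `Leaves.WFLLie.separates`.
[cite: KalethaEtAl2014, Introduction (arXiv:1409.3731v3 main.tex l.69; separation transported here)] -/
theorem unwritten_general_not_implied (rest : Nodes) :
    ∃ (κ : Nodes) (Ω : World) (D : ShapeData Ω), ReadsLeaves κ Ω D ∧ κ.WFL_split ∧ ¬ κ.WFL_general := by
  obtain ⟨Ω, h1, h2, h3⟩ := WFLLie.separates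
  exact ⟨leafNodes Ω (emptyShape Ω) rest, Ω, emptyShape Ω, leafNodes_reads Ω _ rest, ⟨h1, h2⟩, h3⟩

/-- **PROVED SCOPE versus STATEMENT under [KMSW], kernel-checked.**  For any values of the other nodes there is
a reading in which Theorem* 1.6.1 holds in the proved scope at EVERY rank (generic parameters; all extended pure
inner twists of unitary groups over local fields of characteristic zero — `chap4.tex:L1764` "Theorem 1.6.1 has
now been established for all generic parameters and all pure inner twists of unitary groups") while Theorem*
1.6.1 AS STATED fails at some rank (witness: a non-quasi-split `U(3)` over a `p`-adic field with non-generic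
parameters, `innerUnitaryScope`, deferred to the unwritten [KMS_A], `chap1mainthms.tex:L86` "The theorem will
be proven in full in the next paper [KMS_A]").  Transported from `LocalClassification.generic_separates`.
[cite: KalethaEtAl2014, Thm* 1.6.1 preamble (chap1mainthms.tex l.86) and chap4.tex l.1764 (separation transported here)] -/
theorem generic_scope_not_full (rest : Nodes) :
    ∃ (κ : Nodes) (Ω : World) (D : ShapeData Ω),
      ReadsLeaves κ Ω D ∧ (∀ N, κ.T161g N) ∧ ¬ (∀ N, κ.T161 N) := by
  obtain ⟨Ω, D, h1, h2⟩ := LocalClassification.generic_separates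
  exact ⟨leafNodes Ω D rest, Ω, D, leafNodes_reads Ω D rest, fun _ => h1, fun H => h2 (H 0)⟩

end Literature.NumberTheory.Automorphic.KMSW2014
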